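import Summits.AnomalousDissipation.AnomalousDissipation.Theorems.SolenoidalFractalHomogenisationLagrangianStepSidebandSkew
import Summits.AnomalousDissipation.AnomalousDissipation.Theorems.SolenoidalFractalHomogenisationLagrangianStepSidebandSlotDefs
import HarnessLib

/-!
# K1L_D `stub_D1_exactFamily` clause (i) (`stub_D1_residue`, registry v16) — brick A1(c)-I: THE OWN-SLOT ALGEBRA of the truncated sideband
# generator (single-fibre states are `gen`-invariant while their ladder neighbours are link-invisible; block generator; source / feedback on fibres;
# contraction of homogeneous orbits) (helper; `--supports stmt-AnomalousDissipation-27980`)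

Summits-side helper file of route `SolenoidalFractalHomogenisation` (prover seat `ad-sawtooth-k1loc-p1` g12; variant A of D26-6/D26-7, sizing memo
`HOME/ad-sawtooth-k1loc-p1/D1i-sizing-v2-k1locp1g12.md`, identification `κ = 1` of NOTES §01:58Z / j322426).  Everything proved; no definitions (the operators `injL`, `blockGen` are `…SidebandSlotDefs`), no named facts, no sorry.

THE POINT.  `Sideband.psiStar` is the period mean of `feedbackⱼ ∘ response_{j'}`; its diagonal `j = j'` is computed by restricting the truncated fast
dynamics `y' = sourceⱼ v + gen(t) y` to slot `j`, where (this file):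
* (`…SidebandSlotDefs`: `injL R z u` = the state with amplitude `u` on the fibre `z`, `blockGen 𝔸 γ₁ m` = the own-fibre part of `genComp` at `z = m`);
* **`gen_injL`** — if every link that would READ the fibre `m` vanishes (`linkCoeff_{j'}(z') = 0` whenever `z' ∓ m_{j'} = m`), then
  `gen t (injL R m u) = injL R m (blockGen 𝔸 γ₁ m u)`: the fibre is invariant and carries the block dynamics.  During slot `j` this is the case for
  `m = ±mⱼ` (`linkCoeff_eq_zero_of_ladder`: the readers are `z' ∈ {0, ±2mⱼ}`, invisible because `êⱼ·mⱼ = 0`, and the other slots' envelopes vanish —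
  `linkCoeff_eq_zero_of_slotEnvelope`);
* `source_eq_injL` — `sourceⱼ(t) v = injL mⱼ (−2πi envⱼ αⱼ • P v) + injL (−mⱼ) (−2πi envⱼ ᾱⱼ • P v)`; `feedback_injL_self / _neg / _of_ne` — the feedback
  functional reads only the fibres `±mⱼ`;
* **`norm_le_exp_of_hasDerivAt_gen`** — every orbit of the HOMOGENEOUS equation `u' = gen(t) u` on `[t₀, t₁]` contracts:
  `‖u t₁‖ ≤ e^{−min(γ₁,4π²lo')(t₁−t₀)} ‖u t₀‖` (the energy argument of `…SidebandDecay`, freed from the periodic-response packaging) — applied next to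
  the difference between `responseⱼ` and the explicit own-slot Duhamel state (brick A1(c)-II).
NOT a proof of any registered stub, of the crux, or of anomalous dissipation; rung leaf F-D1 infrastructure.
-/

set_option linter.dupNamespace false

noncomputable section

namespace Summit.AnomalousDissipation.AnomalousDissipation.Theorems.SolenoidalFractalHomogenisation.LagrangianStep.Sideband

open Set MeasureTheory Complex
open scoped InnerProductSpace
open Literature.Analysis Literature.Analysis.FunctionSpaces Literature.Analysis.FunctionSpaces.Torus
open Literature.Analysis.FluidPDE Literature.Analysis.FluidPDE.Torus Literature.Analysis.FluidPDE.LatticeShear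
open Summit.AnomalousDissipation.AnomalousDissipation.Theorems.SolenoidalFractalHomogenisation.LagrangianStep.CellChain (linkCoeff)

variable {k₀ : ℕ}

/-! ## §1 Link-invisible fibres are invariant and carry the block dynamics -/

/-- A link coefficient vanishes where its slot envelope does. [cite: MeshalkinSinai1961, pp. 1700–1705] -/
theorem linkCoeff_eq_zero_of_slotEnvelope (W₁ : LatticeWord k₀) (z : Fin 3 → ℤ) {j : Fin k₀} {t : ℝ} (h : slotEnvelope W₁ j t = 0) :
    linkCoeff W₁ 1 z j t = 0 := by
  rw [linkCoeff_eq, h]; simp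

/-- A link coefficient vanishes at a frequency orthogonal to the polarisation: `êⱼ·z = 0 ⇒ linkCoeffⱼ(z) = 0`. [cite: MeshalkinSinai1961, pp. 1700–1705] -/
theorem linkCoeff_eq_zero_of_sum_eq_zero (W₁ : LatticeWord k₀) {z : Fin 3 → ℤ} {j : Fin k₀} (t : ℝ)
    (h : ∑ a, ((W₁.phase j).e a : ℂ) * (z a : ℂ) = 0) : linkCoeff W₁ 1 z j t = 0 := by
  rw [linkCoeff_eq, h]; simp

/-- `êⱼ · mⱼ = 0` in complex coordinates. [cite: MeshalkinSinai1961, pp. 1700–1705] -/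
theorem sum_e_mul_m_eq_zero (W₁ : LatticeWord k₀) (j : Fin k₀) : ∑ a, ((W₁.phase j).e a : ℂ) * ((W₁.phase j).m a : ℂ) = 0 := by
  have h := (W₁.phase j).e_perp
  rw [EuclideanSpace.inner_eq_star_dotProduct] at h
  simp only [star_trivial, dotProduct, Torus.latticeVec_apply] at h
  have h' : ∑ a, (W₁.phase j).e a * ((W₁.phase j).m a : ℝ) = 0 := by
    rw [← h]; exact Finset.sum_congr rfl fun a _ => by ring
  have := congrArg (fun r : ℝ => (r : ℂ)) h'
  push_cast at this
  exact this

/-- **The readers of the fibres `±mⱼ` along slot `j`'s own ladder are link-invisible**: if `z' − mⱼ = ±mⱼ` or `z' + mⱼ = ±mⱼ` for a RETAINED `z'`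
(so `z' ∈ {±2mⱼ}`, `z' = 0` being excluded from the box), then `linkCoeffⱼ(z') = 0`. [cite: MeshalkinSinai1961, pp. 1700–1705] -/
theorem linkCoeff_eq_zero_of_ladder (W₁ : LatticeWord k₀) {R : ℕ} (j : Fin k₀) (t : ℝ) (z' : box R) {m : Fin 3 → ℤ}
    (hm : m = (W₁.phase j).m ∨ m = -(W₁.phase j).m) (h : z'.1 - (W₁.phase j).m = m ∨ z'.1 + (W₁.phase j).m = m) :
    linkCoeff W₁ 1 z'.1 j t = 0 := by
  have hz0 : (z' : Fin 3 → ℤ) ≠ 0 := ne_zero_of_mem_box z'.2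
  have he := sum_e_mul_m_eq_zero W₁ j
  -- in all four cases `z' = c • mⱼ` with `c ∈ {0, 2, -2}`; `c = 0` is excluded
  have key : ∃ c : ℤ, (z' : Fin 3 → ℤ) = c • (W₁.phase j).m := by
    rcases hm with rfl | rfl <;> rcases h with h | h
    · exact ⟨2, by funext i; have := congrFun h i; simp only [Pi.sub_apply] at this; simp only [Pi.smul_apply, smul_eq_mul]; linarith⟩
    · exact ⟨0, by funext i; have := congrFun h i; simp only [Pi.add_apply] at this; simp only [Pi.smul_apply, smul_eq_mul]; linarith⟩
    · exact ⟨0, by funext i; have := congrFun h i; simp only [Pi.sub_apply, Pi.neg_apply] at this; simp only [Pi.smul_apply, smul_eq_mul]; linarith⟩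
    · exact ⟨-2, by funext i; have := congrFun h i; simp only [Pi.add_apply, Pi.neg_apply] at this; simp only [Pi.smul_apply, smul_eq_mul]; linarith⟩
  obtain ⟨c, hc⟩ := key
  apply linkCoeff_eq_zero_of_sum_eq_zero
  rw [hc]
  simp only [Pi.smul_apply, smul_eq_mul, Int.cast_mul]
  calc ∑ a, ((W₁.phase j).e a : ℂ) * ((c : ℂ) * ((W₁.phase j).m a : ℂ))
      = (c : ℂ) * ∑ a, ((W₁.phase j).e a : ℂ) * ((W₁.phase j).m a : ℂ) := by rw [Finset.mul_sum]; exact Finset.sum_congr rfl fun a _ => by ring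
    _ = 0 := by rw [he, mul_zero]

/-- **INVARIANCE OF A LINK-INVISIBLE FIBRE.**  If every link that would read the fibre `m` vanishes at time `t` (`linkCoeff_{j'}(z') = 0` whenever
`z' − m_{j'} = m` or `z' + m_{j'} = m`), then the single-fibre state `injL R m u` is mapped by `gen(t)` to the single-fibre state carrying the block
dynamics: `gen t (injL R m u) = injL R m (blockGen 𝔸 γ₁ m u)`. [cite: MajdaKramer1999, §2.2.1.3 (cell problem (49))] -/
theorem gen_injL (W₁ : LatticeWord k₀) (𝔸 : Torus.Visc4 (Fin 3)) (γ₁ : ℝ) {R : ℕ} {t : ℝ} {m : Fin 3 → ℤ} (hm : m ∈ box R)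
    (hlink : ∀ (j' : Fin k₀) (z' : box R), (z'.1 - (W₁.phase j').m = m ∨ z'.1 + (W₁.phase j').m = m) → linkCoeff W₁ 1 z'.1 j' t = 0)
    (u : EuclideanSpace ℂ (Fin 3)) :
    gen W₁ 𝔸 γ₁ R t (injL R m u) = injL R m (blockGen 𝔸 γ₁ m u) := by
  ext z' : 1
  rw [gen_apply, genComp_apply, injL_apply]
  have hlinks : ∑ j, linkCoeff W₁ 1 z'.1 j t • transversalProj z'.1
      (slotAmp W₁ j • transversalProj (z'.1 - (W₁.phase j).m) (coordL R (z'.1 - (W₁.phase j).m) (injL R m u)) +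
        starRingEnd ℂ (slotAmp W₁ j) • transversalProj (z'.1 + (W₁.phase j).m) (coordL R (z'.1 + (W₁.phase j).m) (injL R m u))) = 0 := by
    refine Finset.sum_eq_zero fun j _ => ?_
    by_cases h : z'.1 - (W₁.phase j).m = m ∨ z'.1 + (W₁.phase j).m = m
    · rw [hlink j z' h, zero_smul]
    · rw [not_or] at h
      rw [coordL_injL_of_ne h.1, coordL_injL_of_ne h.2]
      simp
  rw [hlinks, sub_zero]
  by_cases hz : (z' : Fin 3 → ℤ) = m
  · rw [if_pos hz, hz, coordL_injL_self hm, blockGen_apply]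
  · rw [if_neg hz, coordL_injL_of_ne hz]
    simp

/-- **During slot `j` the fibres `±mⱼ` are link-invisible**: if the envelopes of all other slots vanish at `t`, the hypothesis of `gen_injL` holds at
`m = mⱼ` and at `m = −mⱼ`. [cite: MeshalkinSinai1961, pp. 1700–1705] -/
theorem links_invisible_of_slot (W₁ : LatticeWord k₀) {R : ℕ} (j : Fin k₀) {t : ℝ} (hoff : ∀ j', j' ≠ j → slotEnvelope W₁ j' t = 0)
    {m : Fin 3 → ℤ} (hm : m = (W₁.phase j).m ∨ m = -(W₁.phase j).m) :
    ∀ (j' : Fin k₀) (z' : box R), (z'.1 - (W₁.phase j').m = m ∨ z'.1 + (W₁.phase j').m = m) → linkCoeff W₁ 1 z'.1 j' t = 0 := by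
  intro j' z' h
  by_cases hj : j' = j
  · subst hj; exact linkCoeff_eq_zero_of_ladder W₁ j' t z' hm h
  · exact linkCoeff_eq_zero_of_slotEnvelope W₁ z'.1 (hoff j' hj)

/-- **Own-slot block dynamics on the fibre `mⱼ`.** [cite: MajdaKramer1999, §2.2.1.3 (cell problem (49))] -/
theorem gen_injL_self (W₁ : LatticeWord k₀) (𝔸 : Torus.Visc4 (Fin 3)) (γ₁ : ℝ) {R : ℕ} (j : Fin k₀) {t : ℝ}
    (hoff : ∀ j', j' ≠ j → slotEnvelope W₁ j' t = 0) (hm : (W₁.phase j).m ∈ box R) (u : EuclideanSpace ℂ (Fin 3)) :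
    gen W₁ 𝔸 γ₁ R t (injL R (W₁.phase j).m u) = injL R (W₁.phase j).m (blockGen 𝔸 γ₁ (W₁.phase j).m u) :=
  gen_injL W₁ 𝔸 γ₁ hm (links_invisible_of_slot W₁ j hoff (Or.inl rfl)) u

/-- **Own-slot block dynamics on the fibre `−mⱼ`.** [cite: MajdaKramer1999, §2.2.1.3 (cell problem (49))] -/
theorem gen_injL_neg (W₁ : LatticeWord k₀) (𝔸 : Torus.Visc4 (Fin 3)) (γ₁ : ℝ) {R : ℕ} (j : Fin k₀) {t : ℝ}
    (hoff : ∀ j', j' ≠ j → slotEnvelope W₁ j' t = 0) (hm : -(W₁.phase j).m ∈ box R) (u : EuclideanSpace ℂ (Fin 3)) :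
    gen W₁ 𝔸 γ₁ R t (injL R (-(W₁.phase j).m) u) = injL R (-(W₁.phase j).m) (blockGen 𝔸 γ₁ (-(W₁.phase j).m) u) :=
  gen_injL W₁ 𝔸 γ₁ hm (links_invisible_of_slot W₁ j hoff (Or.inr rfl)) u

/-! ## §3 Source and feedback on fibres -/

/-- **The unit source of slot `j` is a two-fibre state**: `sourceⱼ(t) v = injL mⱼ (−2πi envⱼ αⱼ • P_{mⱼ} v) + injL (−mⱼ) (−2πi envⱼ ᾱⱼ • P_{−mⱼ} v)`.
[cite: MajdaKramer1999, §2.2.1.3 (cell problem (49), source term)] -/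
theorem source_eq_injL (W₁ : LatticeWord k₀) (R : ℕ) (j : Fin k₀) (t : ℝ) (v : EuclideanSpace ℂ (Fin 3)) :
    source W₁ R j t v =
      injL R (W₁.phase j).m ((-(2 * Real.pi * Complex.I * ((slotEnvelope W₁ j t : ℝ) : ℂ) * slotAmp W₁ j)) • transversalProj (W₁.phase j).m v) +
      injL R (-(W₁.phase j).m) ((-(2 * Real.pi * Complex.I * ((slotEnvelope W₁ j t : ℝ) : ℂ) * starRingEnd ℂ (slotAmp W₁ j))) •
        transversalProj (-(W₁.phase j).m) v) := by
  ext z' : 1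
  rw [source_apply, PiLp.add_apply, injL_apply, injL_apply, sourceComp, add_apply]
  congr 1
  · split_ifs with h
    · rw [smul_apply, h]
    · rfl
  · split_ifs with h
    · rw [smul_apply, h]
    · rfl

/-- The feedback functional of slot `j` on a single-fibre state (general fibre). [cite: MajdaKramer1999, §2.2.1.3 (55)] -/
theorem feedback_injL (W₁ : LatticeWord k₀) (R : ℕ) (j : Fin k₀) (t : ℝ) (z : Fin 3 → ℤ) (u : EuclideanSpace ℂ (Fin 3)) :
    feedback W₁ R j t (injL R z u) = (2 * Real.pi * Complex.I * ((slotEnvelope W₁ j t : ℝ) : ℂ)) •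
      (slotAmp W₁ j • coordL R (-(W₁.phase j).m) (injL R z u) + starRingEnd ℂ (slotAmp W₁ j) • coordL R (W₁.phase j).m (injL R z u)) := by
  simp only [feedback, smul_apply, add_apply]

/-- `mⱼ ≠ −mⱼ`. [cite: MeshalkinSinai1961, pp. 1700–1705] -/
theorem m_ne_neg_m (W₁ : LatticeWord k₀) (j : Fin k₀) : (W₁.phase j).m ≠ -(W₁.phase j).m := by
  intro h
  apply (W₁.phase j).m_ne
  funext i
  have := congrFun h i
  simp only [Pi.neg_apply] at this
  simp only [Pi.zero_apply]; omega

/-- Reading a retained fibre (subtype form, no anonymous constructor). [cite: MajdaKramer1999, §2.2.1.3] -/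
theorem coordL_coe_apply {R : ℕ} (z : box R) (y : Space R) : coordL R (z : Fin 3 → ℤ) y = y z := by
  rw [coordL_apply_of_mem z.2]

/-- A fibre into which no link feeds carries the block dynamics: if `linkCoeff_{j'}(z) = 0` for all `j'`, then `(gen t y)_z = blockGen 𝔸 γ₁ z (y_z)` for
every state `y`. [cite: MajdaKramer1999, §2.2.1.3 (cell problem (49))] -/
theorem genComp_eq_blockGen (W₁ : LatticeWord k₀) (𝔸 : Torus.Visc4 (Fin 3)) (γ₁ : ℝ) {R : ℕ} {t : ℝ} (z : box R)
    (hl : ∀ j' : Fin k₀, linkCoeff W₁ 1 z.1 j' t = 0) (y : Space R) :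
    genComp W₁ 𝔸 γ₁ R t z y = blockGen 𝔸 γ₁ z.1 (coordL R z.1 y) := by
  rw [genComp_apply, blockGen_apply]
  simp only [hl, zero_smul, Finset.sum_const_zero, sub_zero]

/-- During slot `j` no link reads INTO the fibres `±mⱼ` (subtype form): the links at `z = ±mⱼ` carry the factor `êⱼ·mⱼ = 0`, the other slots are off.
[cite: MeshalkinSinai1961, pp. 1700–1705] -/
theorem linkCoeff_eq_zero_of_slot (W₁ : LatticeWord k₀) (j : Fin k₀) {t : ℝ} (hoff : ∀ j', j' ≠ j → slotEnvelope W₁ j' t = 0)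
    {m : Fin 3 → ℤ} (hm : m = (W₁.phase j).m ∨ m = -(W₁.phase j).m) (j' : Fin k₀) : linkCoeff W₁ 1 m j' t = 0 := by
  by_cases hj : j' = j
  · subst hj
    have he := sum_e_mul_m_eq_zero W₁ j'
    apply linkCoeff_eq_zero_of_sum_eq_zero W₁ t
    rcases hm with h | h
    · rw [h]; exact he
    · rw [h]; simp only [Pi.neg_apply, Int.cast_neg, mul_neg, Finset.sum_neg_distrib, he, neg_zero]
  · exact linkCoeff_eq_zero_of_slotEnvelope W₁ m (hoff j' hj)

/-- **THE OWN FIBRE IS CLOSED DURING ITS SLOT** (subtype form): for a retained `z` with `z = ±mⱼ` and all other envelopes off at `t`,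
`(gen t y) z = blockGen 𝔸 γ₁ z (y z)` for EVERY state `y`. [cite: MajdaKramer1999, §2.2.1.3 (cell problem (49))] -/
theorem apply_gen_of_slot (W₁ : LatticeWord k₀) (𝔸 : Torus.Visc4 (Fin 3)) (γ₁ : ℝ) {R : ℕ} (j : Fin k₀) {t : ℝ}
    (hoff : ∀ j', j' ≠ j → slotEnvelope W₁ j' t = 0) (z : box R) (hm : z.1 = (W₁.phase j).m ∨ z.1 = -(W₁.phase j).m) (y : Space R) :
    gen W₁ 𝔸 γ₁ R t y z = blockGen 𝔸 γ₁ z.1 (y z) := by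
  rw [gen_apply, genComp_eq_blockGen W₁ 𝔸 γ₁ z (linkCoeff_eq_zero_of_slot W₁ j hoff hm) y, coordL_coe_apply]

/-- **THE OWN FIBRE IS CLOSED DURING ITS SLOT.**  If the envelopes of all other slots vanish at `t`, nobody feeds INTO the fibre `mⱼ`: for EVERY state
`y`, `(gen t y)_{mⱼ} = blockGen 𝔸 γ₁ mⱼ (y_{mⱼ})` read through `coordL` (the links at `z = mⱼ` carry the factor `êⱼ·mⱼ = 0`; the other slots are off);
the same at `−mⱼ`.  Hence the amplitude `t ↦ (N t v)_{±mⱼ}` of ANY solution of `y' = sourceⱼ v + gen y` solves a closed linear ODE on `ℂ³` during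
slot `j`. [cite: MajdaKramer1999, §2.2.1.3 (cell problem (49))] [cite: MeshalkinSinai1961, pp. 1700–1705] -/
theorem coordL_gen_of_slot (W₁ : LatticeWord k₀) (𝔸 : Torus.Visc4 (Fin 3)) (γ₁ : ℝ) (R : ℕ) (j : Fin k₀) {t : ℝ}
    (hoff : ∀ j', j' ≠ j → slotEnvelope W₁ j' t = 0) {m : Fin 3 → ℤ} (hm : m = (W₁.phase j).m ∨ m = -(W₁.phase j).m) (y : Space R) :
    coordL R m (gen W₁ 𝔸 γ₁ R t y) = blockGen 𝔸 γ₁ m (coordL R m y) := by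
  by_cases hmb : m ∈ box R
  · obtain ⟨z, rfl⟩ : ∃ z : box R, (z : Fin 3 → ℤ) = m := ⟨⟨m, hmb⟩, rfl⟩
    rw [coordL_coe_apply, coordL_coe_apply]
    exact apply_gen_of_slot W₁ 𝔸 γ₁ j hoff z hm y
  · rw [coordL_apply_of_not_mem hmb, coordL_apply_of_not_mem hmb, map_zero]

/-- The own-fibre amplitude of a solution of `y' = sourceⱼ(t) v + gen(t) y` solves, during slot `j`, the CLOSED fibre equation
`u' = −2πi envⱼ αⱼ • P_{mⱼ} v + blockGen u` (read through `coordL`; at `−mⱼ` with `ᾱⱼ`). [cite: MajdaKramer1999, §2.2.1.3 (cell problem (49))] -/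
theorem hasDerivAt_coordL_of_slot (W₁ : LatticeWord k₀) (𝔸 : Torus.Visc4 (Fin 3)) (γ₁ : ℝ) (R : ℕ) (j : Fin k₀) {t : ℝ}
    (hoff : ∀ j', j' ≠ j → slotEnvelope W₁ j' t = 0) {m : Fin 3 → ℤ} (hm : m = (W₁.phase j).m ∨ m = -(W₁.phase j).m)
    {Y : ℝ → Space R} {v : EuclideanSpace ℂ (Fin 3)}
    (hY : HasDerivAt Y (source W₁ R j t v + ((gen W₁ 𝔸 γ₁ R t).restrictScalars ℝ) (Y t)) t) :
    HasDerivAt (fun s => coordL R m (Y s)) (coordL R m (source W₁ R j t v) + blockGen 𝔸 γ₁ m (coordL R m (Y t))) t := by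
  have h := ((coordL R m).restrictScalars ℝ).hasFDerivAt.comp_hasDerivAt t hY
  have he : ((coordL R m).restrictScalars ℝ) (source W₁ R j t v + ((gen W₁ 𝔸 γ₁ R t).restrictScalars ℝ) (Y t)) =
      coordL R m (source W₁ R j t v) + blockGen 𝔸 γ₁ m (coordL R m (Y t)) := by
    rw [ContinuousLinearMap.coe_restrictScalars', map_add, ContinuousLinearMap.coe_restrictScalars', coordL_gen_of_slot W₁ 𝔸 γ₁ R j hoff hm]
  rw [he] at h
  exact h

/-- The source read on the fibre `mⱼ`. [cite: MajdaKramer1999, §2.2.1.3 (cell problem (49), source term)] -/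
theorem coordL_source_self (W₁ : LatticeWord k₀) {R : ℕ} (j : Fin k₀) (t : ℝ) (hm : (W₁.phase j).m ∈ box R) (v : EuclideanSpace ℂ (Fin 3)) :
    coordL R (W₁.phase j).m (source W₁ R j t v) =
      (-(2 * Real.pi * Complex.I * ((slotEnvelope W₁ j t : ℝ) : ℂ) * slotAmp W₁ j)) • transversalProj (W₁.phase j).m v := by
  rw [coordL_apply_of_mem hm, source_apply]
  show sourceComp W₁ R j t ⟨(W₁.phase j).m, hm⟩ v = _
  rw [sourceComp, add_apply, if_pos rfl, if_neg (m_ne_neg_m W₁ j), smul_apply, zero_apply, add_zero]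

/-- The source read on the fibre `−mⱼ`. [cite: MajdaKramer1999, §2.2.1.3 (cell problem (49), source term)] -/
theorem coordL_source_neg (W₁ : LatticeWord k₀) {R : ℕ} (j : Fin k₀) (t : ℝ) (hm : -(W₁.phase j).m ∈ box R) (v : EuclideanSpace ℂ (Fin 3)) :
    coordL R (-(W₁.phase j).m) (source W₁ R j t v) =
      (-(2 * Real.pi * Complex.I * ((slotEnvelope W₁ j t : ℝ) : ℂ) * starRingEnd ℂ (slotAmp W₁ j))) • transversalProj (-(W₁.phase j).m) v := by
  rw [coordL_apply_of_mem hm, source_apply]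
  show sourceComp W₁ R j t ⟨-(W₁.phase j).m, hm⟩ v = _
  rw [sourceComp, add_apply, if_neg (Ne.symm (m_ne_neg_m W₁ j)), if_pos rfl, smul_apply, zero_apply, zero_add]

/-- The feedback functional through `coordL` (unfolding). [cite: MajdaKramer1999, §2.2.1.3 (55)] -/
theorem feedback_apply (W₁ : LatticeWord k₀) (R : ℕ) (j : Fin k₀) (t : ℝ) (y : Space R) :
    feedback W₁ R j t y = (2 * Real.pi * Complex.I * ((slotEnvelope W₁ j t : ℝ) : ℂ)) •
      (slotAmp W₁ j • coordL R (-(W₁.phase j).m) y + starRingEnd ℂ (slotAmp W₁ j) • coordL R (W₁.phase j).m y) := by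
  simp only [feedback, smul_apply, add_apply]

/-- **Feedback reads the fibre `mⱼ` with weight `2πi envⱼ ᾱⱼ`.** [cite: MajdaKramer1999, §2.2.1.3 (55)] -/
theorem feedback_injL_self (W₁ : LatticeWord k₀) {R : ℕ} (j : Fin k₀) (t : ℝ) (hm : (W₁.phase j).m ∈ box R) (u : EuclideanSpace ℂ (Fin 3)) :
    feedback W₁ R j t (injL R (W₁.phase j).m u) =
      (2 * Real.pi * Complex.I * ((slotEnvelope W₁ j t : ℝ) : ℂ)) • (starRingEnd ℂ (slotAmp W₁ j) • u) := by
  rw [feedback_injL, coordL_injL_of_ne (Ne.symm (m_ne_neg_m W₁ j)), coordL_injL_self hm, smul_zero, zero_add]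

/-- **Feedback reads the fibre `−mⱼ` with weight `2πi envⱼ αⱼ`.** [cite: MajdaKramer1999, §2.2.1.3 (55)] -/
theorem feedback_injL_neg (W₁ : LatticeWord k₀) {R : ℕ} (j : Fin k₀) (t : ℝ) (hm : -(W₁.phase j).m ∈ box R) (u : EuclideanSpace ℂ (Fin 3)) :
    feedback W₁ R j t (injL R (-(W₁.phase j).m) u) =
      (2 * Real.pi * Complex.I * ((slotEnvelope W₁ j t : ℝ) : ℂ)) • (slotAmp W₁ j • u) := by
  rw [feedback_injL, coordL_injL_self hm, coordL_injL_of_ne (m_ne_neg_m W₁ j), smul_zero, add_zero]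

/-- **Feedback is blind to every other fibre.** [cite: MajdaKramer1999, §2.2.1.3 (55)] -/
theorem feedback_injL_of_ne (W₁ : LatticeWord k₀) (R : ℕ) (j : Fin k₀) (t : ℝ) {z : Fin 3 → ℤ} (h₁ : z ≠ (W₁.phase j).m)
    (h₂ : z ≠ -(W₁.phase j).m) (u : EuclideanSpace ℂ (Fin 3)) : feedback W₁ R j t (injL R z u) = 0 := by
  rw [feedback_injL, coordL_injL_of_ne (Ne.symm h₂), coordL_injL_of_ne (Ne.symm h₁), smul_zero, smul_zero, add_zero, smul_zero]

/-- Feedback vanishes where its envelope does. [cite: MajdaKramer1999, §2.2.1.3 (55)] -/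
theorem feedback_eq_zero_of_slotEnvelope (W₁ : LatticeWord k₀) (R : ℕ) (j : Fin k₀) {t : ℝ} (ht : slotEnvelope W₁ j t = 0) :
    feedback W₁ R j t = 0 := by
  ext y : 1
  rw [feedback, smul_apply, ht, Complex.ofReal_zero, mul_zero, zero_smul, zero_apply]

/-! ## §4 Contraction of homogeneous orbits -/

/-- **CONTRACTION OF HOMOGENEOUS ORBITS.**  For `NearIso 𝔸 lo' hi'`, `lo' ≥ 0`: every solution of `u' = gen(t) u` on `[t₀, t₁]` satisfies
`‖u t₁‖ ≤ e^{−min(γ₁, 4π²lo')(t₁ − t₀)} ‖u t₀‖` (energy identity + `real_inner_gen_le`). [cite: SandersVerhulstMurdock2007, Lemma 5.2.7 (linear case)] -/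
theorem norm_le_exp_of_hasDerivAt_gen (W₁ : LatticeWord k₀) {𝔸 : Torus.Visc4 (Fin 3)} {lo' hi' : ℝ}
    (h𝔸 : Torus.NearIso 𝔸 lo' hi') (hlo' : 0 ≤ lo') (γ₁ : ℝ) (R : ℕ) {u : ℝ → Space R} {t₀ t₁ : ℝ} (h01 : t₀ ≤ t₁)
    (hderiv : ∀ t ∈ Icc t₀ t₁, HasDerivAt u (((gen W₁ 𝔸 γ₁ R t).restrictScalars ℝ) (u t)) t) :
    ‖u t₁‖ ≤ Real.exp (-(min γ₁ (4 * Real.pi ^ 2 * lo') * (t₁ - t₀))) * ‖u t₀‖ := by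
  set r := min γ₁ (4 * Real.pi ^ 2 * lo') with hr
  -- energy `ψ = e^{2rt}‖u‖²` is non-increasing
  set ψ : ℝ → ℝ := fun t => Real.exp (2 * r * t) * ‖u t‖ ^ 2 with hψ
  have hψd : ∀ t ∈ Icc t₀ t₁, HasDerivAt ψ (Real.exp (2 * r * t) * (2 * r) * ‖u t‖ ^ 2
      + Real.exp (2 * r * t) * (2 * ⟪u t, ((gen W₁ 𝔸 γ₁ R t).restrictScalars ℝ) (u t)⟫_ℝ)) t := by
    intro t ht
    have h1 : HasDerivAt (fun s => Real.exp (2 * r * s)) (Real.exp (2 * r * t) * (2 * r)) t := by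
      simpa using ((hasDerivAt_id t).const_mul (2 * r)).exp
    have h2 : HasDerivAt (fun s => ‖u s‖ ^ 2) (2 * ⟪u t, ((gen W₁ 𝔸 γ₁ R t).restrictScalars ℝ) (u t)⟫_ℝ) t := by
      have h := (hderiv t ht).norm_sq
      simpa using h
    exact h1.mul h2
  have hψle : ∀ t ∈ Icc t₀ t₁, Real.exp (2 * r * t) * (2 * r) * ‖u t‖ ^ 2
      + Real.exp (2 * r * t) * (2 * ⟪u t, ((gen W₁ 𝔸 γ₁ R t).restrictScalars ℝ) (u t)⟫_ℝ) ≤ 0 := by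
    intro t _
    have hg := real_inner_gen_le W₁ h𝔸 hlo' γ₁ R t (u t)
    rw [real_inner_comm] at hg
    have he : 0 < Real.exp (2 * r * t) := Real.exp_pos _
    have : ⟪u t, ((gen W₁ 𝔸 γ₁ R t).restrictScalars ℝ) (u t)⟫_ℝ ≤ -r * ‖u t‖ ^ 2 := by
      simpa [hr] using hg
    nlinarith
  have hanti : AntitoneOn ψ (Icc t₀ t₁) := by
    refine antitoneOn_of_deriv_nonpos (convex_Icc t₀ t₁) ?_ ?_ ?_
    · exact fun t ht => (hψd t ht).continuousAt.continuousWithinAt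
    · intro t ht
      rw [interior_Icc] at ht
      exact (hψd t ⟨ht.1.le, ht.2.le⟩).differentiableAt.differentiableWithinAt
    · intro t ht
      rw [interior_Icc] at ht
      rw [(hψd t ⟨ht.1.le, ht.2.le⟩).deriv]
      exact hψle t ⟨ht.1.le, ht.2.le⟩
  have hmono := hanti (left_mem_Icc.2 h01) (right_mem_Icc.2 h01) h01
  simp only [hψ] at hmono
  have hsq : ‖u t₁‖ ^ 2 ≤ (Real.exp (-(r * (t₁ - t₀))) * ‖u t₀‖) ^ 2 := by
    rw [mul_pow, ← Real.exp_nat_mul]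
    have hexp : Real.exp (↑(2:ℕ) * -(r * (t₁ - t₀))) * Real.exp (2 * r * t₁) = Real.exp (2 * r * t₀) := by
      rw [← Real.exp_add]; congr 1; push_cast; ring
    have := mul_le_mul_of_nonneg_left hmono (Real.exp_pos (↑(2:ℕ) * -(r * (t₁ - t₀)))).le
    rw [← mul_assoc, ← mul_assoc, hexp] at this
    have he1 : 0 < Real.exp (2 * r * t₀) := Real.exp_pos _
    nlinarith [this]
  have hnn : 0 ≤ Real.exp (-(r * (t₁ - t₀))) * ‖u t₀‖ := by positivity
  exact (abs_le_of_sq_le_sq' hsq hnn).2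

/-- **Contraction without rate** (the case used for the own-slot difference): `‖u t₁‖ ≤ ‖u t₀‖` when `γ₁ ≥ 0`. [cite: SandersVerhulstMurdock2007, Lemma 5.2.7] -/
theorem norm_le_of_hasDerivAt_gen (W₁ : LatticeWord k₀) {𝔸 : Torus.Visc4 (Fin 3)} {lo' hi' : ℝ}
    (h𝔸 : Torus.NearIso 𝔸 lo' hi') (hlo' : 0 ≤ lo') {γ₁ : ℝ} (hγ₁ : 0 ≤ γ₁) (R : ℕ) {u : ℝ → Space R} {t₀ t₁ : ℝ} (h01 : t₀ ≤ t₁)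
    (hderiv : ∀ t ∈ Icc t₀ t₁, HasDerivAt u (((gen W₁ 𝔸 γ₁ R t).restrictScalars ℝ) (u t)) t) :
    ‖u t₁‖ ≤ ‖u t₀‖ := by
  have h := norm_le_exp_of_hasDerivAt_gen W₁ h𝔸 hlo' γ₁ R h01 hderiv
  have hr : 0 ≤ min γ₁ (4 * Real.pi ^ 2 * lo') := le_min hγ₁ (by positivity)
  have he : Real.exp (-(min γ₁ (4 * Real.pi ^ 2 * lo') * (t₁ - t₀))) ≤ 1 := by
    rw [Real.exp_le_one_iff]; nlinarith [sub_nonneg.2 h01]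
  exact h.trans ((mul_le_of_le_one_left (norm_nonneg _) he))

end Summit.AnomalousDissipation.AnomalousDissipation.Theorems.SolenoidalFractalHomogenisation.LagrangianStep.Sideband
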